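import Summits.QuantumFields.YangMills.Theorems.F4SubCurvatureDoorSubCurvatureClauseMixedTwoPointShift
import HarnessLib

/-!
# Route `F4SubCurvatureDoor`, crux `SubCurvatureClause` ⟨stmt-QuantumFields-23763⟩ — the MIXED (reflected-density × density) lattice
# two-point distributions have the same off-diagonal limit as the density two-point distributions

Helper file (`--supports stmt-QuantumFields-23763 --as helper`; free-hands seat `ym-line-frs-p2` g19, the «density swap» step of the soft
stub `LatticeToAxis` of the crux idea «rp-moebius-ladder», letter agreed with ym-idea-3 g25 2026-08-29T22:43Z/23:2xZ).  Definition-free,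
0 sorry, standard axioms.  No item is closed; no summit, no crux and no mass gap is proved by this file.

WHAT.  On the odd torus `2L+1` let `ω(x, y) := Cov_T(dens x, (dens (θ₀y)) ∘ Θ₀) = Cov_T(Q_x, Q^θ_y)` be the truncated correlation of the
action density at `x` with the SITE-REFLECTED density `Q^θ = r.curvature.timeReflect` translated to `y` (`Θ₀ = cfgReflect`).  Since
`Q^θ_y = Σ_{spatial q} plane q y + Σ_{electric q} plane q (y − e₀)` (✓`cov_dens_mul_dens_cfgReflect_eq_sum`), the smeared mixed sum
`M(F) = Σ_{z ∈ box²} ω(z₀, z₁) F(a z)` differs from the density two-point lattice distribution `latticeDist … 2 F` by plane-string sums against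
the ONE-LATTICE-STEP difference `F(a z + a e₀ ⊗ δ₁) − F(a z)` (reindexing inside the box for test functions supported in `‖·‖ ≤ ρ < aL`),
which the shift-defect bound of toolkit XIV-b (✓`exists_planeString_bounds` (ii), from `MomentBounds6`) controls by `O(a)`:

* tools in ✓`…SubCurvatureClauseMixedTwoPointShift` (reindexing, plane-pair covariances = string weights, the lowered electric sum);
* `mixed_sub_latticeDist_eq` / `norm_mixed_sub_latticeDist_le` (§3): `M(F) − latticeDist 2 F` = electric shift defects, `≤ 256·(2aK²Σ⁺(F))`;
* ★ `tendsto_mixed_of_offDiagLimitAlong` (§4): along every admissible leg scheme under `MomentBounds6`, for every compactly supported off-diagonal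
  `F`, `M_k(F) → S₁ 2 F` for every off-diagonal limit point `S₁`.

[cite: OsterwalderSeiler1978, §2]; [folklore; Glimm–Jaffe 1987 §6.1].

HONEST LABEL: lattice bookkeeping toward a soft stub; the crux content (`MoebiusRow`, `CrossoverDecay`) is untouched; ⟨23763⟩, ⟨23036⟩ open; the
Yang–Mills mass gap is NOT proved; no summit is proved by a line.
-/

set_option autoImplicit false

noncomputable section

open scoped SchwartzMap BigOperators
open MeasureTheory Filter Topology Metric Set
open Literature.MathematicalPhysics.QuantumFieldTheory Literature.MathematicalPhysics.QuantumLattice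
open Literature.MathematicalPhysics.AQFT
open Literature.Probability.LatticeModels (box Site mem_box)
open Summit.QuantumFields.YangMills.Cruxes.OSLegsFromFemtoAndGap.DlrCollarTransfer
  (dens plane torusE MomentBounds6 continuous_plane continuous_dens)
open Summit.QuantumFields.YangMills.Cruxes.OSLegsAtWeakCouplingC.Sketch (tendsto_riemann_sum)
open Summit.QuantumFields.YangMills.Theorems.OSLegsFromFemtoAndGap
open Summit.QuantumFields.YangMills.Theorems.ROT (IsLegScheme OffDiagLimitAlong)
open Summit.QuantumFields.YangMills.Theorems.NPointIsotropy.Negative (E4)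
open Summit.QuantumFields.YangMills.Cruxes.NT.CumulantPolarisation (torusE_centred_centred)
open Summit.QuantumFields.YangMills.Cruxes.UniversalDetectorPlaneTight
  (cov_dens_mul_dens_cfgReflect_eq_sum cov_dens_eq_sum_cov_plane_univ)

open Summit.QuantumFields.YangMills.Theorems.F4SubCurvatureDoorSubCurvatureClauseMixedTwoPointShift
  (covPlane_eq_torusMomentStr sum_covPlane_lower_eq)

namespace Summit.QuantumFields.YangMills.Theorems.F4SubCurvatureDoorSubCurvatureClauseMixedTwoPoint

variable {G : Type} [Group G] [TopologicalSpace G] [IsTopologicalGroup G] [CompactSpace G]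
  [MeasurableSpace G] [BorelSpace G]

/-- **The mixed smeared sum minus the density two-point lattice distribution is a sum of electric shift defects**: for `F` supported in
`‖·‖ ≤ ρ < aL`,
`Σ_z Cov_T(dens z₀, dens (θ₀z₁) ∘ Θ₀) F(a z) − latticeDist 2 F = Σ_p Σ_{q electric} Σ_z W^{pq}(z) (F(a z + a e₀ ⊗ δ₁) − F(a z))`.
[cite: OsterwalderSeiler1978, §2] -/
theorem mixed_sub_latticeDist_eq (r : LatticeRep G) (β : ℝ) (L : ℕ) {a ρ : ℝ} (ha : 0 ≤ a)
    (F : 𝓢((Fin 2 → E4), ℂ)) (hF : tsupport (F : (Fin 2 → E4) → ℂ) ⊆ closedBall 0 ρ) (hρ : ρ < a * L) :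
    (∑ z ∈ Fintype.piFinset (fun _ : Fin 2 => box 4 L),
        ((torusE G r β L (fun V => dens G r (z 0) V * dens G r (siteReflect (z 1)) (cfgReflect V)) -
            torusE G r β L (dens G r (z 0)) * torusE G r β L (dens G r (siteReflect (z 1))) : ℝ) : ℂ) *
          F (fun l => a • siteToE (z l))) -
      latticeDist r.ρ β L a r.curvature.F (wilsonTorusMean r.ρ β L r.curvature.F) 2 F =
    ∑ p : {q : Fin 4 × Fin 4 // q.1 < q.2}, ∑ q : {q : Fin 4 × Fin 4 // q.1 < q.2},
      if q.1.1 = 0 then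
        ∑ z ∈ Fintype.piFinset (fun _ : Fin 2 => box 4 L),
          ((torusMomentStr r.ρ β L (fun i U => plaquetteObs r.ρ 0 ((![p.1, q.1] : Fin 2 → Fin 4 × Fin 4) i).1
              ((![p.1, q.1] : Fin 2 → Fin 4 × Fin 4) i).2 U)
            (fun i => wilsonTorusMean r.ρ β L (fun U => plaquetteObs r.ρ 0 ((![p.1, q.1] : Fin 2 → Fin 4 × Fin 4) i).1
              ((![p.1, q.1] : Fin 2 → Fin 4 × Fin 4) i).2 U)) z : ℝ) : ℂ) *
            (F ((fun l => a • siteToE (z l)) + fun l => a • siteToE ((fun i : Fin 2 => if i = 1 then (Pi.single 0 1 : Site 4) else 0) l)) -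
              F (fun l => a • siteToE (z l)))
      else 0 := by
  classical
  -- both weights as plane-pair sums
  have hmix : ∀ z : Fin 2 → Site 4,
      torusE G r β L (fun V => dens G r (z 0) V * dens G r (siteReflect (z 1)) (cfgReflect V)) -
          torusE G r β L (dens G r (z 0)) * torusE G r β L (dens G r (siteReflect (z 1))) =
        ∑ p : {q : Fin 4 × Fin 4 // q.1 < q.2}, ∑ q : {q : Fin 4 × Fin 4 // q.1 < q.2},
          (torusE G r β L (fun V => plane G r p.1 (z 0) V * plane G r q.1 (if q.1.1 = 0 then z 1 - Pi.single 0 1 else z 1) V) -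
            torusE G r β L (plane G r p.1 (z 0)) *
              torusE G r β L (plane G r q.1 (if q.1.1 = 0 then z 1 - Pi.single 0 1 else z 1))) := by
    intro z
    rw [cov_dens_mul_dens_cfgReflect_eq_sum r β L (z 0) (siteReflect (z 1))]
    simp only [siteReflect_siteReflect]
  have hplain : ∀ z : Fin 2 → Site 4,
      torusMoment r.ρ β L r.curvature.F (wilsonTorusMean r.ρ β L r.curvature.F) z =
        ∑ p : {q : Fin 4 × Fin 4 // q.1 < q.2}, ∑ q : {q : Fin 4 × Fin 4 // q.1 < q.2},
          (torusE G r β L (fun V => plane G r p.1 (z 0) V * plane G r q.1 (z 1) V) -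
            torusE G r β L (plane G r p.1 (z 0)) * torusE G r β L (plane G r q.1 (z 1))) := by
    intro z
    rw [torusMoment_two, cov_dens_eq_sum_cov_plane_univ r β L (z 0) (z 1)]
  -- pointwise in `z`: the difference of the weights is the double plane sum of the differences
  have hpt : ∀ z : Fin 2 → Site 4,
      (((torusE G r β L (fun V => dens G r (z 0) V * dens G r (siteReflect (z 1)) (cfgReflect V)) -
            torusE G r β L (dens G r (z 0)) * torusE G r β L (dens G r (siteReflect (z 1))) : ℝ) : ℂ) -
          ((torusMoment r.ρ β L r.curvature.F (wilsonTorusMean r.ρ β L r.curvature.F) z : ℝ) : ℂ)) *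
        F (fun l => a • siteToE (z l)) =
      ∑ p : {q : Fin 4 × Fin 4 // q.1 < q.2}, ∑ q : {q : Fin 4 × Fin 4 // q.1 < q.2},
        ((((torusE G r β L (fun V => plane G r p.1 (z 0) V * plane G r q.1 (if q.1.1 = 0 then z 1 - Pi.single 0 1 else z 1) V) -
            torusE G r β L (plane G r p.1 (z 0)) *
              torusE G r β L (plane G r q.1 (if q.1.1 = 0 then z 1 - Pi.single 0 1 else z 1))) -
          (torusE G r β L (fun V => plane G r p.1 (z 0) V * plane G r q.1 (z 1) V) -
            torusE G r β L (plane G r p.1 (z 0)) * torusE G r β L (plane G r q.1 (z 1))) : ℝ) : ℂ) *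
          F (fun l => a • siteToE (z l))) := by
    intro z
    rw [hmix z, hplain z, ← Complex.ofReal_sub, ← Finset.sum_sub_distrib]
    simp_rw [← Finset.sum_sub_distrib]
    push_cast
    rw [Finset.sum_mul]
    refine Finset.sum_congr rfl fun p _ => ?_
    rw [Finset.sum_mul]
  rw [latticeDist_apply, ← Finset.sum_sub_distrib]
  have hstep : ∀ z ∈ Fintype.piFinset (fun _ : Fin 2 => box 4 L),
      ((torusE G r β L (fun V => dens G r (z 0) V * dens G r (siteReflect (z 1)) (cfgReflect V)) -
            torusE G r β L (dens G r (z 0)) * torusE G r β L (dens G r (siteReflect (z 1))) : ℝ) : ℂ) *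
          F (fun l => a • siteToE (z l)) -
        ((torusMoment r.ρ β L r.curvature.F (wilsonTorusMean r.ρ β L r.curvature.F) z : ℝ) : ℂ) *
          F (fun l => a • siteToE (z l)) =
      ∑ p : {q : Fin 4 × Fin 4 // q.1 < q.2}, ∑ q : {q : Fin 4 × Fin 4 // q.1 < q.2},
        ((((torusE G r β L (fun V => plane G r p.1 (z 0) V * plane G r q.1 (if q.1.1 = 0 then z 1 - Pi.single 0 1 else z 1) V) -
            torusE G r β L (plane G r p.1 (z 0)) *
              torusE G r β L (plane G r q.1 (if q.1.1 = 0 then z 1 - Pi.single 0 1 else z 1))) -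
          (torusE G r β L (fun V => plane G r p.1 (z 0) V * plane G r q.1 (z 1) V) -
            torusE G r β L (plane G r p.1 (z 0)) * torusE G r β L (plane G r q.1 (z 1))) : ℝ) : ℂ) *
          F (fun l => a • siteToE (z l))) := by
    intro z _
    rw [← sub_mul]
    exact hpt z
  rw [Finset.sum_congr rfl hstep, Finset.sum_comm]
  refine Finset.sum_congr rfl fun p _ => ?_
  rw [Finset.sum_comm]
  refine Finset.sum_congr rfl fun q _ => ?_
  by_cases hq : q.1.1 = 0
  · simp only [hq, ↓reduceIte]
    have hlow := sum_covPlane_lower_eq r β L ha F hF hρ p.1 q.1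
    calc ∑ z ∈ Fintype.piFinset (fun _ : Fin 2 => box 4 L),
          ((((torusE G r β L (fun V => plane G r p.1 (z 0) V * plane G r q.1 (z 1 - Pi.single 0 1) V) -
              torusE G r β L (plane G r p.1 (z 0)) * torusE G r β L (plane G r q.1 (z 1 - Pi.single 0 1))) -
            (torusE G r β L (fun V => plane G r p.1 (z 0) V * plane G r q.1 (z 1) V) -
              torusE G r β L (plane G r p.1 (z 0)) * torusE G r β L (plane G r q.1 (z 1))) : ℝ) : ℂ) *
            F (fun l => a • siteToE (z l)))
        = ∑ z ∈ Fintype.piFinset (fun _ : Fin 2 => box 4 L),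
            ((torusE G r β L (fun V => plane G r p.1 (z 0) V * plane G r q.1 (z 1 - Pi.single 0 1) V) -
                torusE G r β L (plane G r p.1 (z 0)) * torusE G r β L (plane G r q.1 (z 1 - Pi.single 0 1)) : ℝ) : ℂ) *
              F (fun l => a • siteToE (z l)) -
          ∑ z ∈ Fintype.piFinset (fun _ : Fin 2 => box 4 L),
            ((torusE G r β L (fun V => plane G r p.1 (z 0) V * plane G r q.1 (z 1) V) -
                torusE G r β L (plane G r p.1 (z 0)) * torusE G r β L (plane G r q.1 (z 1)) : ℝ) : ℂ) *
              F (fun l => a • siteToE (z l)) := by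
          rw [← Finset.sum_sub_distrib]
          refine Finset.sum_congr rfl fun z _ => ?_
          push_cast
          ring
      _ = _ := by
          rw [hlow, ← Finset.sum_sub_distrib]
          refine Finset.sum_congr rfl fun z _ => ?_
          rw [covPlane_eq_torusMomentStr r β L p.1 q.1 z]
          ring
  · simp only [hq, ↓reduceIte, sub_self, Complex.ofReal_zero, zero_mul, Finset.sum_const_zero]

/-- **The mixed smeared sum is within `O(a)` of the density two-point lattice distribution**, given the shift-defect bound for length-2 plane
strings at `(β, L, a)` (toolkit XIV-b ✓`exists_planeString_bounds` (ii) supplies it from `MomentBounds6`): for off-diagonal `F` supported in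
`‖·‖ ≤ ρ < aL`, `‖M(F) − latticeDist 2 F‖ ≤ 256 · (2 a K² Σ⁺(F))`. -/
theorem norm_mixed_sub_latticeDist_le (r : LatticeRep G) (β : ℝ) (L : ℕ) {a ρ K : ℝ} (ha : 0 ≤ a) (hK : 0 ≤ K)
    (F : 𝓢((Fin 2 → E4), ℂ)) (hF : tsupport (F : (Fin 2 → E4) → ℂ) ⊆ closedBall 0 ρ) (hρ : ρ < a * L)
    (hdef : ∀ rr : Fin 2 → Fin 4 × Fin 4, (∀ i, (rr i).1 < (rr i).2) → ∀ c : Fin 2 → E4, (∀ l, ‖c l‖ ≤ a) →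
      ‖∑ z ∈ Fintype.piFinset (fun _ : Fin 2 => box 4 L),
          ((torusMomentStr r.ρ β L (fun i U => plaquetteObs r.ρ 0 (rr i).1 (rr i).2 U)
            (fun i => wilsonTorusMean r.ρ β L (fun U => plaquetteObs r.ρ 0 (rr i).1 (rr i).2 U)) z : ℝ) : ℂ) *
          (F ((fun l => a • siteToE (z l)) + c) - F (fun l => a • siteToE (z l)))‖ ≤
        2 * ‖c‖ * K ^ 2 * (SchwartzMap.seminorm ℂ 0 (4 * 2 + 1) F + SchwartzMap.seminorm ℂ (6 * 2) (4 * 2 + 1) F +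
          SchwartzMap.seminorm ℂ 0 1 F + SchwartzMap.seminorm ℂ (6 * 2) 1 F + SchwartzMap.seminorm ℂ (10 * 2) 1 F)) :
    ‖(∑ z ∈ Fintype.piFinset (fun _ : Fin 2 => box 4 L),
        ((torusE G r β L (fun V => dens G r (z 0) V * dens G r (siteReflect (z 1)) (cfgReflect V)) -
            torusE G r β L (dens G r (z 0)) * torusE G r β L (dens G r (siteReflect (z 1))) : ℝ) : ℂ) *
          F (fun l => a • siteToE (z l))) -
      latticeDist r.ρ β L a r.curvature.F (wilsonTorusMean r.ρ β L r.curvature.F) 2 F‖ ≤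
      256 * (2 * a * K ^ 2 * (SchwartzMap.seminorm ℂ 0 (4 * 2 + 1) F + SchwartzMap.seminorm ℂ (6 * 2) (4 * 2 + 1) F +
          SchwartzMap.seminorm ℂ 0 1 F + SchwartzMap.seminorm ℂ (6 * 2) 1 F + SchwartzMap.seminorm ℂ (10 * 2) 1 F)) := by
  classical
  set Sp : ℝ := SchwartzMap.seminorm ℂ 0 (4 * 2 + 1) F + SchwartzMap.seminorm ℂ (6 * 2) (4 * 2 + 1) F +
    SchwartzMap.seminorm ℂ 0 1 F + SchwartzMap.seminorm ℂ (6 * 2) 1 F + SchwartzMap.seminorm ℂ (10 * 2) 1 F with hSp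
  have hSp0 : 0 ≤ Sp := by positivity
  set B0 : ℝ := 2 * a * K ^ 2 * Sp with hB0
  have hB00 : 0 ≤ B0 := by positivity
  rw [mixed_sub_latticeDist_eq r β L ha F hF hρ]
  -- the shift vector `c = (0, a e₀)`
  set δ : Fin 2 → Site 4 := fun i => if i = 1 then Pi.single 0 1 else 0 with hδdef
  set c : Fin 2 → E4 := fun l => a • siteToE (δ l) with hc
  have hcl : ∀ l, ‖c l‖ ≤ a := by
    intro l
    rw [hc]
    simp only
    by_cases hl : l = 1
    · subst hl
      simp only [hδdef, if_true, norm_smul, Real.norm_eq_abs, abs_of_nonneg ha, norm_siteToE_single, mul_one, le_refl]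
    · have h0 : siteToE (0 : Site 4) = (0 : E4) := by
        ext i; simp [siteToE_apply]
      simp [hδdef, hl, h0, ha]
  have hcn : ‖c‖ ≤ a := (pi_norm_le_iff_of_nonneg ha).2 hcl
  -- each of the `≤ 16 × 16` terms is bounded by `B0`
  have hterm : ∀ (p q : {q : Fin 4 × Fin 4 // q.1 < q.2}),
      ‖(if q.1.1 = 0 then
          ∑ z ∈ Fintype.piFinset (fun _ : Fin 2 => box 4 L),
            ((torusMomentStr r.ρ β L (fun i U => plaquetteObs r.ρ 0 ((![p.1, q.1] : Fin 2 → Fin 4 × Fin 4) i).1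
                ((![p.1, q.1] : Fin 2 → Fin 4 × Fin 4) i).2 U)
              (fun i => wilsonTorusMean r.ρ β L (fun U => plaquetteObs r.ρ 0 ((![p.1, q.1] : Fin 2 → Fin 4 × Fin 4) i).1
                ((![p.1, q.1] : Fin 2 → Fin 4 × Fin 4) i).2 U)) z : ℝ) : ℂ) *
              (F ((fun l => a • siteToE (z l)) + fun l => a • siteToE ((fun i : Fin 2 => if i = 1 then (Pi.single 0 1 : Site 4) else 0) l)) -
                F (fun l => a • siteToE (z l)))
        else 0)‖ ≤ B0 := by
    intro p q
    by_cases hq : q.1.1 = 0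
    · simp only [hq, ↓reduceIte]
      have hrr : ∀ i : Fin 2, ((![p.1, q.1] : Fin 2 → Fin 4 × Fin 4) i).1 < ((![p.1, q.1] : Fin 2 → Fin 4 × Fin 4) i).2 := by
        intro i
        fin_cases i
        · simpa using p.2
        · simpa using q.2
      have h := hdef ![p.1, q.1] hrr c hcl
      refine h.trans ?_
      rw [hB0]
      have : 2 * ‖c‖ * K ^ 2 * Sp ≤ 2 * a * K ^ 2 * Sp :=
        mul_le_mul_of_nonneg_right (mul_le_mul_of_nonneg_right (by linarith) (pow_nonneg hK 2)) hSp0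
      exact this
    · simp only [hq, ↓reduceIte, norm_zero]
      exact hB00
  have hcard : (Fintype.card {q : Fin 4 × Fin 4 // q.1 < q.2} : ℝ) ≤ 16 := by
    have h := Fintype.card_subtype_le (fun q : Fin 4 × Fin 4 => q.1 < q.2)
    simp only [Fintype.card_prod, Fintype.card_fin] at h
    exact_mod_cast h
  have hcard0 : (0 : ℝ) ≤ Fintype.card {q : Fin 4 × Fin 4 // q.1 < q.2} := Nat.cast_nonneg _
  calc ‖∑ p : {q : Fin 4 × Fin 4 // q.1 < q.2}, ∑ q : {q : Fin 4 × Fin 4 // q.1 < q.2}, _‖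
      ≤ ∑ p : {q : Fin 4 × Fin 4 // q.1 < q.2}, ‖∑ q : {q : Fin 4 × Fin 4 // q.1 < q.2}, _‖ := norm_sum_le _ _
    _ ≤ ∑ p : {q : Fin 4 × Fin 4 // q.1 < q.2}, ∑ q : {q : Fin 4 × Fin 4 // q.1 < q.2}, B0 :=
        Finset.sum_le_sum fun p _ => (norm_sum_le _ _).trans (Finset.sum_le_sum fun q _ => hterm p q)
    _ = (Fintype.card {q : Fin 4 × Fin 4 // q.1 < q.2} : ℝ) * ((Fintype.card {q : Fin 4 × Fin 4 // q.1 < q.2} : ℝ) * B0) := by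
        simp only [Finset.sum_const, Finset.card_univ, nsmul_eq_mul]
    _ ≤ 16 * (16 * B0) := by
        refine mul_le_mul hcard (mul_le_mul_of_nonneg_right hcard hB00) (by positivity) (by norm_num)
    _ = 256 * B0 := by ring

/-! ## §4 ★ The mixed two-point sums converge to the off-diagonal limit -/

/-- ★ **The MIXED two-point lattice sums have the same off-diagonal limit as the density two-point distributions.**  Under
`MomentBounds6 G r a`, along every admissible leg scheme and subsequence `φ → ∞` with off-diagonal limit point `S₁`, for every compactly
supported off-diagonal `F`:
`Σ_{z ∈ box²} Cov_T(dens z₀, dens (θ₀z₁) ∘ Θ₀) · F(a_k z) → S₁ 2 F`, i.e. the reflected density may replace the density in one slot.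
[cite: OsterwalderSeiler1978, §2] -/
theorem tendsto_mixed_of_offDiagLimitAlong (r : LatticeRep G) {a : ℝ → ℝ} (hMB : MomentBounds6 G r a)
    {sch : SpeciesScheme (YMSpecies G)} (hsch : IsLegScheme a sch) {φ : ℕ → ℕ} (hφ : Tendsto φ atTop atTop)
    {S₁ : SchwingerFamily E4} (hS₁ : OffDiagLimitAlong r sch φ S₁)
    (F : 𝓢((Fin 2 → E4), ℂ)) (hFoff : IsOffDiagonal F) (hFc : HasCompactSupport (F : (Fin 2 → E4) → ℂ)) :
    Tendsto (fun k => ∑ z ∈ Fintype.piFinset (fun _ : Fin 2 => box 4 (sch.L (φ k))),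
        ((torusE G r (sch.β (φ k)) (sch.L (φ k))
              (fun V => dens G r (z 0) V * dens G r (siteReflect (z 1)) (cfgReflect V)) -
            torusE G r (sch.β (φ k)) (sch.L (φ k)) (dens G r (z 0)) *
              torusE G r (sch.β (φ k)) (sch.L (φ k)) (dens G r (siteReflect (z 1))) : ℝ) : ℂ) *
          F (fun l => sch.a (φ k) • siteToE (z l))) atTop (𝓝 (S₁ 2 F)) := by
  classical
  obtain ⟨hunits, hβ, hranges⟩ := hsch
  obtain ⟨-, -, hconv⟩ := hS₁
  obtain ⟨β₄, ℓ₄, K, hℓ, hK, H⟩ := exists_planeString_bounds r hMB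
  -- support radius
  obtain ⟨ρ, hρ0, hρ⟩ : ∃ ρ : ℝ, 0 ≤ ρ ∧ tsupport (F : (Fin 2 → E4) → ℂ) ⊆ closedBall (0 : Fin 2 → E4) ρ := by
    obtain ⟨ρ, hρ⟩ := hFc.isCompact.isBounded.subset_closedBall 0
    exact ⟨max ρ 0, le_max_right _ _, hρ.trans (closedBall_subset_closedBall (le_max_left _ _))⟩
  set Sp : ℝ := SchwartzMap.seminorm ℂ 0 (4 * 2 + 1) F + SchwartzMap.seminorm ℂ (6 * 2) (4 * 2 + 1) F +
    SchwartzMap.seminorm ℂ 0 1 F + SchwartzMap.seminorm ℂ (6 * 2) 1 F + SchwartzMap.seminorm ℂ (10 * 2) 1 F with hSp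
  -- the density distributions converge
  have hlim := hconv 2 le_rfl F hFoff
  -- the difference is eventually `≤ 256 · 2 a_k K² Σ⁺`
  have hθ : Tendsto (fun k => φ k) atTop atTop := hφ
  have ha0 : Tendsto (fun k => sch.a (φ k)) atTop (𝓝 0) := sch.tendsto_a.comp hθ
  have haL : Tendsto (fun k => sch.a (φ k) * (sch.L (φ k) : ℝ)) atTop atTop := sch.tendsto_L.comp hθ
  have hev : ∀ᶠ k in atTop,
      ‖(∑ z ∈ Fintype.piFinset (fun _ : Fin 2 => box 4 (sch.L (φ k))),
          ((torusE G r (sch.β (φ k)) (sch.L (φ k))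
                (fun V => dens G r (z 0) V * dens G r (siteReflect (z 1)) (cfgReflect V)) -
              torusE G r (sch.β (φ k)) (sch.L (φ k)) (dens G r (z 0)) *
                torusE G r (sch.β (φ k)) (sch.L (φ k)) (dens G r (siteReflect (z 1))) : ℝ) : ℂ) *
            F (fun l => sch.a (φ k) • siteToE (z l))) -
        latticeDist r.ρ (sch.β (φ k)) (sch.L (φ k)) (sch.a (φ k)) r.curvature.F
          (wilsonTorusMean r.ρ (sch.β (φ k)) (sch.L (φ k)) r.curvature.F) 2 F‖ ≤
        256 * (2 * sch.a (φ k) * K ^ 2 * Sp) := by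
    filter_upwards [(hβ.comp hθ).eventually_ge_atTop β₄, ha0.eventually (gt_mem_nhds hℓ),
      haL.eventually_gt_atTop ρ] with k hkβ hkℓ hkL
    obtain ⟨-, ha24, hL14, hLa⟩ := hranges (φ k)
    have hak : 0 < sch.a (φ k) := sch.a_pos _
    have hunit : sch.a (φ k) = a (sch.β (φ k)) := hunits _
    have Hk := H (sch.β (φ k)) hkβ (by rw [← hunit]; exact hak) (by rw [← hunit]; exact ha24)
      (by rw [← hunit]; exact hkℓ.le) (sch.L (φ k)) hL14 (by rw [← hunit]; exact hLa) 2 le_rfl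
    refine norm_mixed_sub_latticeDist_le r (sch.β (φ k)) (sch.L (φ k)) hak.le hK F hρ hkL ?_
    intro rr hrr c hcl
    have h2 := (Hk rr hrr F hFoff).2 c (fun l => by rw [← hunit]; exact hcl l)
    rw [← hunit] at h2
    exact h2
  have hdiff : Tendsto (fun k =>
      (∑ z ∈ Fintype.piFinset (fun _ : Fin 2 => box 4 (sch.L (φ k))),
          ((torusE G r (sch.β (φ k)) (sch.L (φ k))
                (fun V => dens G r (z 0) V * dens G r (siteReflect (z 1)) (cfgReflect V)) -
              torusE G r (sch.β (φ k)) (sch.L (φ k)) (dens G r (z 0)) *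
                torusE G r (sch.β (φ k)) (sch.L (φ k)) (dens G r (siteReflect (z 1))) : ℝ) : ℂ) *
            F (fun l => sch.a (φ k) • siteToE (z l))) -
        latticeDist r.ρ (sch.β (φ k)) (sch.L (φ k)) (sch.a (φ k)) r.curvature.F
          (wilsonTorusMean r.ρ (sch.β (φ k)) (sch.L (φ k)) r.curvature.F) 2 F) atTop (𝓝 0) := by
    refine squeeze_zero_norm' hev ?_
    have : Tendsto (fun k => 256 * (2 * sch.a (φ k) * K ^ 2 * Sp)) atTop (𝓝 (256 * (2 * 0 * K ^ 2 * Sp))) :=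
      ((((tendsto_const_nhds.mul ha0).mul tendsto_const_nhds).mul tendsto_const_nhds).const_mul 256)
    simpa using this
  have h := hlim.add hdiff
  simp only [add_zero] at h
  refine h.congr fun k => ?_
  abel

end Summit.QuantumFields.YangMills.Theorems.F4SubCurvatureDoorSubCurvatureClauseMixedTwoPoint

end
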